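import Summits.Ventures.GridStability.Bench.GFMSMIBDeg2AQoriaV4physK32RoaModel
import Summits.Ventures.GridStability.Bench.GFMSMIBDeg2AQoriaV4physRoaModel
import Summits.Ventures.GridStability.Bench.GFMSMIBDeg2AQoriaV4physLevelCeiling
import HarnessLib

/-!
# GFMSMIBDeg2AQoriaV4physK32Lever — the ARC LEVER in one place: SAME `V`, certified level 55 → 83 by re-declaring
# the arc bound κ ≤ 1 → κ ≤ 3/2, strictly past the record arc box's exit level 55.3692 (G3.a-arc32, GFM-SMIB deg-2)

Venture GRIDFUSION, LADDER T1 INSTRUMENT (memo §3.S2 levers) / G3.a-arc32 improvement row (CERTS.tsv row 405: A ✓ R165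
`cert/A/GFM-SMIB-deg2-A-QoriaV4phys-k32.json` b3b0c1b216841415 (sos-1 j260452), B ✓ R216 (sos-2 j261757), ref-1 recompute row 90;
Lean leg gridfusion-sos-5 g7). This file only LINKS kernel objects already in the tree:
* the RECORD certificate `GFM-SMIB-deg2-A-QoriaV4phys` (Bench/GFMSMIBDeg2AQoriaV4phys{Data,,Roa,RoaModel}.lean, ★ G3.a: `V` of
  degree 2, level `55`, ball `φ = σ² + κ² + ω²/4500 ≤ 3`, arc `κ ≤ 1`) and its hypothesis-free ROA readings
  (`deg2_A_QoriaV4phys_gfmQoriaV4Phys_roa`, `…_droop_roa`);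
* its LEVEL CEILING (Bench/GFMSMIBDeg2AQoriaV4physLevelCeiling.lean, lit-5 g11, filed p606443): the BINDING identity of the record
  object is the ARC box — `{V ≤ c} ∩ {h = 0}` leaves `κ ≤ 1` exactly from
  `c = deg2_A_QoriaV4phys_arc_excl_exitLevel = 132912639076110452213941/2400480048002400060000 ≈ 55.3692`, so NO certificate of any
  shape certifies a level `≥ 55.3692` for this `V` with THAT arc bound (the ball `φ ≤ 3` only exits near 83.75);
* the ARC-LEVER certificate `GFM-SMIB-deg2-A-QoriaV4phys-k32` (Bench/GFMSMIBDeg2AQoriaV4physK32{Data,,Roa,RoaModel}.lean): the SAME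
  `V`, `f`, `h`, `φ`, `ε`, ball `φ ≤ 3`; arc bound `κ ≤ 3/2` (`|u| ≤ 120°`, still inside the angle chart: `cos u ≥ −1/2 > −1`), level `83`.

THREE COLUMNS. CERTIFIED (kernel, this file): (1) the two Bench objects have the same `V`, `h` and vector field
(`…_k32_V_eq_record`, `…_h_eq_record`, `…_f_…_eq_record`, `…_F_eq_record`); (2) `55 < 55.3692… < 83` (`…_k32_levels`): the new certified
level lies STRICTLY ABOVE the record arc box's exit level; (3) the record exit point `z* = (200020000/200020001, 200040002/200020001, −1/6)`
— outside the record arc box, `κ(z*) = 1 + 1/200020001 > 1` — lies INSIDE the new certified piece (`h(z*) = 0`, `V(z*) ≤ 83`, `κ(z*) ≤ 3/2`,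
`φ(z*) ≤ 3`; `…_k32_exitPoint_mem`); (4) the hypothesis-free ROA sentence for model-1's physical-time twin `SMIB.gfmQoriaV4Phys` now
holds for every `γ ≤ 83` with the RECORD `V` (`…_k32_gfmQoriaV4Phys_roa_83`), whereas the record object gives it for `γ ≤ 55`.
VALIDATED (provenance only): A's clarabel run j260452 and B's CVXOPT re-certification j261757 (day 1); lit-5's exit scan (GFMSMIB row of STATUS
l.7770: binding = arc box at 55.3692, ball exits ≈ 83.75 at u = 120°, no falsifying point of `−V̇ − εφ` inside the ball on a 720 × 401 grid).
MODELLED: M′ = GFM-SMIB-QoriaV4(phys) = reduced-order droop / virtual-synchronous-machine grid-forming converter against an infinite bus,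
read as a classical SMIB with `M = 113/3550`, `D/M = 33` (MODEL-VALIDITY MV-6D+MV-P+MV-Ω(ω_b′ = 35500/113): inner loops, filter / line /
dc-side dynamics, current limits ABSENT); «certified level» = of THIS `V` on the stated domain; both sets are INNER estimates of the model's
region of attraction; nothing here is about a physical converter or grid.
-/

namespace Summit.Ventures.GridStability.Bench.GFMSMIB

open Set Filter Topology Real
open Summit.Ventures.GridStability.Models
open Literature.Computation.Certificates Literature.Computation.Certificates.SOS
open Literature.Computation.Certificates.SOS.Poly

/-! ### (1) Same `V`, same constraint, same field as the record object -/

/-- The arc-lever object's `V` IS the record certificate's `V` (same seven rational coefficients). [folklore] -/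
theorem deg2_A_QoriaV4phys_k32_V_eq_record (sigma kappa omega : ℝ) :
    deg2_A_QoriaV4phys_k32_V sigma kappa omega = deg2_A_QoriaV4phys_V sigma kappa omega := by
  have h1 := deg2_A_QoriaV4phys_k32_V_eq sigma kappa omega
  have h2 := deg2_A_QoriaV4phys_V_eq sigma kappa omega
  linear_combination h1 - h2

/-- Same polynomialisation constraint `h`. [folklore] -/
theorem deg2_A_QoriaV4phys_k32_h_eq_record (sigma kappa omega : ℝ) :
    deg2_A_QoriaV4phys_k32_h sigma kappa omega = deg2_A_QoriaV4phys_h sigma kappa omega := by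
  have h1 := deg2_A_QoriaV4phys_k32_h_eq sigma kappa omega
  have h2 := deg2_A_QoriaV4phys_h_eq sigma kappa omega
  linear_combination h1 - h2

/-- Same recast vector field, component `σ̇`. [folklore] -/
theorem deg2_A_QoriaV4phys_k32_f_sigma_eq_record (sigma kappa omega : ℝ) :
    deg2_A_QoriaV4phys_k32_f_sigma sigma kappa omega = deg2_A_QoriaV4phys_f_sigma sigma kappa omega := by
  have h1 := deg2_A_QoriaV4phys_k32_f_sigma_eq sigma kappa omega
  have h2 := deg2_A_QoriaV4phys_f_sigma_eq sigma kappa omega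
  linear_combination h1 - h2

/-- Same recast vector field, component `κ̇`. [folklore] -/
theorem deg2_A_QoriaV4phys_k32_f_kappa_eq_record (sigma kappa omega : ℝ) :
    deg2_A_QoriaV4phys_k32_f_kappa sigma kappa omega = deg2_A_QoriaV4phys_f_kappa sigma kappa omega := by
  have h1 := deg2_A_QoriaV4phys_k32_f_kappa_eq sigma kappa omega
  have h2 := deg2_A_QoriaV4phys_f_kappa_eq sigma kappa omega
  linear_combination h1 - h2

/-- Same recast vector field, component `ω̇`. [folklore] -/
theorem deg2_A_QoriaV4phys_k32_f_omega_eq_record (sigma kappa omega : ℝ) :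
    deg2_A_QoriaV4phys_k32_f_omega sigma kappa omega = deg2_A_QoriaV4phys_f_omega sigma kappa omega := by
  have h1 := deg2_A_QoriaV4phys_k32_f_omega_eq sigma kappa omega
  have h2 := deg2_A_QoriaV4phys_f_omega_eq sigma kappa omega
  linear_combination h1 - h2

/-- Hence the same recast system on `Fin 3 → ℝ` (the two Roa companions' fields coincide). [folklore] -/
theorem deg2_A_QoriaV4phys_k32_F_eq_record :
    deg2_A_QoriaV4phys_k32_F = deg2_A_QoriaV4phys_F := by
  funext z i
  fin_cases i <;>
    simp [deg2_A_QoriaV4phys_k32_F, deg2_A_QoriaV4phys_F, deg2_A_QoriaV4phys_k32_f_sigma_eq_record,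
      deg2_A_QoriaV4phys_k32_f_kappa_eq_record, deg2_A_QoriaV4phys_k32_f_omega_eq_record]

/-! ### (2) The levels: record 55 < record arc box's exit level 55.3692… < new certified level 83 -/

/-- **LEVEL ORDER** (CERTIFIED, exact arithmetic): record certified level `55` < the record arc box's exit level
`132912639076110452213941/2400480048002400060000 ≈ 55.3692` (above which NOTHING certifies with `κ ≤ 1`) < the level `83` certified with
the re-declared arc bound `κ ≤ 3/2`. [folklore] -/
theorem deg2_A_QoriaV4phys_k32_levels :
    deg2_A_QoriaV4phys_level < (deg2_A_QoriaV4phys_arc_excl_exitLevel : ℝ) ∧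
      (deg2_A_QoriaV4phys_arc_excl_exitLevel : ℝ) < deg2_A_QoriaV4phys_k32_level ∧
        deg2_A_QoriaV4phys_level = (55 : ℝ) ∧ deg2_A_QoriaV4phys_k32_level = (83 : ℝ) := by
  refine ⟨?_, ?_, rfl, rfl⟩
  · norm_num [deg2_A_QoriaV4phys_level, deg2_A_QoriaV4phys_arc_excl_exitLevel]
  · norm_num [deg2_A_QoriaV4phys_k32_level, deg2_A_QoriaV4phys_arc_excl_exitLevel]

/-! ### (3) The record arc box's exit point is inside the new certified piece -/

/-- **THE RECORD EXIT POINT IS NOW CERTIFIED** (exact arithmetic): `z* = (200020000/200020001, 200040002/200020001, −1/6)` —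
the point where `{V ≤ c} ∩ {h = 0}` leaves the record arc box `κ ≤ 1` (`κ(z*) = 1 + 1/200020001`, Bench/…LevelCeiling) —
satisfies `h(z*) = 0`, `V(z*) ≤ 83`, `κ(z*) ≤ 3/2` and `φ(z*) ≤ 3`, i.e. it belongs to the arc-lever object's certified piece
`{h = 0} ∩ {V ≤ 83}` (on which `V̇ ≤ −φ/2000`, `φ ≤ 3`, `κ ≤ 3/2` are kernel-certified). [folklore] -/
theorem deg2_A_QoriaV4phys_k32_exitPoint_mem :
    deg2_A_QoriaV4phys_k32_h (200020000 / 200020001) (200040002 / 200020001) (-1 / 6) = 0 ∧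
      deg2_A_QoriaV4phys_k32_V (200020000 / 200020001) (200040002 / 200020001) (-1 / 6) ≤ deg2_A_QoriaV4phys_k32_level ∧
        (1 : ℝ) < (200040002 / 200020001 : ℝ) ∧ (200040002 / 200020001 : ℝ) ≤ (3 : ℝ) / 2 ∧
          (200020000 / 200020001 : ℝ) ^ 2 + (200040002 / 200020001 : ℝ) ^ 2 + (-1 / 6 : ℝ) ^ 2 / 4500 ≤ (3 : ℝ) := by
  refine ⟨?_, ?_, ?_, ?_, ?_⟩
  · rw [deg2_A_QoriaV4phys_k32_h_eq]; norm_num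
  · rw [deg2_A_QoriaV4phys_k32_V_eq, deg2_A_QoriaV4phys_k32_level]; norm_num
  · norm_num
  · norm_num
  · norm_num

/-! ### (4) The ROA sentence at the new level, next to the record one -/

/-- **ARC LEVER, HYPOTHESIS-FREE READING** (MODELLED: M′ = model-1's physical-time twin `SMIB.gfmQoriaV4Phys` of the
grid-forming-converter instance GFM-SMIB-QoriaV4(phys)): for every solution `x = (δ, ω)` of `SMIB.gfmQoriaV4Phys` on `[0, ∞)`
with `V(sin u₀, 1 − cos u₀, ω₀) ≤ 83` and `|u₀| < π` (`u = δ − δ*`, `δ* = SMIB.deltaQV4`; `V` = the RECORD `V`): `V ≤ 83` and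
`|u t| < π` for all `t ≥ 0`, and `(δ t, ω t) → (δ*, 0)` — the record companion `deg2_A_QoriaV4phys_gfmQoriaV4Phys_roa` reaches
`55` with the same `V`, and `55 < 55.3692 (record arc box's ceiling) < 83`. Both are INNER estimates for the MODEL; no sentence
here says a converter or a grid is stable. [folklore] -/
theorem deg2_A_QoriaV4phys_k32_gfmQoriaV4Phys_roa_83
    {x : ℝ → ℝ × ℝ} (hx : SMIB.gfmQoriaV4Phys.IsSolutionOn x (Ici 0))
    (h0V : deg2_A_QoriaV4phys_V (sin ((x 0).1 - SMIB.deltaQV4)) (1 - cos ((x 0).1 - SMIB.deltaQV4)) (x 0).2 ≤ (83 : ℝ))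
    (h0win : |(x 0).1 - SMIB.deltaQV4| < π) :
    ((∀ t, 0 ≤ t → deg2_A_QoriaV4phys_V (sin ((x t).1 - SMIB.deltaQV4)) (1 - cos ((x t).1 - SMIB.deltaQV4)) (x t).2 ≤ (83 : ℝ) ∧
        |(x t).1 - SMIB.deltaQV4| < π) ∧ Tendsto x atTop (𝓝 (SMIB.deltaQV4, 0))) ∧
      deg2_A_QoriaV4phys_level < (deg2_A_QoriaV4phys_arc_excl_exitLevel : ℝ) ∧
        (deg2_A_QoriaV4phys_arc_excl_exitLevel : ℝ) < (83 : ℝ) := by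
  have hlev : deg2_A_QoriaV4phys_k32_level = (83 : ℝ) := rfl
  have h0V' : deg2_A_QoriaV4phys_k32_V (sin ((x 0).1 - SMIB.deltaQV4)) (1 - cos ((x 0).1 - SMIB.deltaQV4)) (x 0).2 ≤
      deg2_A_QoriaV4phys_k32_level := by
    rw [deg2_A_QoriaV4phys_k32_V_eq_record, hlev]; exact h0V
  obtain ⟨hinv, hlim⟩ := deg2_A_QoriaV4phys_k32_gfmQoriaV4Phys_roa (γ := deg2_A_QoriaV4phys_k32_level)
    (by rw [hlev]; norm_num) le_rfl hx h0V' h0win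
  obtain ⟨hl1, hl2, -, -⟩ := deg2_A_QoriaV4phys_k32_levels
  refine ⟨⟨fun t ht ↦ ⟨?_, (hinv t ht).2⟩, hlim⟩, hl1, by rw [← hlev]; exact hl2⟩
  have h := (hinv t ht).1
  rw [deg2_A_QoriaV4phys_k32_V_eq_record, hlev] at h
  exact h

end Summit.Ventures.GridStability.Bench.GFMSMIB
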